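import Summits.KontsevichZagierPeriods.KontsevichZagierPeriods.Theses.AbelContraction
import Summits.KontsevichZagierPeriods.KontsevichZagierPeriods.Theorems.AbelContractionRealArcKernelSplit
import Summits.KontsevichZagierPeriods.KontsevichZagierPeriods.Theorems.AbelContractionRealArcKernelStubSolids
import Summits.KontsevichZagierPeriods.KontsevichZagierPeriods.Theorems.AbelContractionRealArcKernelStubMergeSolids

/-!
# KontsevichZagierPeriods / AbelContraction — crux `RealArcKernel` (stmt-KontsevichZagierPeriods-12472),
# line `dimtwo_redirect`: the stratum stub `stub_kzDimTwo` (= item stmt-4280) reduced to Hilbert's third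
# problem for bounded `ℚ`-semialgebraic solids in `ℝ³` (support file, lands `--supports`)

With the two landed sub-stubs of the planner line `bounded_solids` of stmt-4280 —
`RealArcKernelStubSolids.stub_solids` (every representation of dimension `≤ 2` is `≡ [s] − [s′]`
modulo `KZ.relations` with `s, s′` BOUNDED volume representations of dimension `3`, p148539) and
`RealArcKernelStubMergeSolids.stub_mergeSolids` (two bounded volume representations of dimension `3`
merge into one, p148371) — the stratum piece `KZDimTwo` of the crux, and with it the crux and the
summit modulo `ReductionToDimensionTwo` (stmt-18030), follow from ONE open statement, the
dimension-`3` bounded layer of the Cresson–Viu-Sos volume conjecture: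

  `SolidVolumes₃` : two bounded volume representations `u v : KZ.IntegralRep 3` (bounded
  `ℚ`-semialgebraic domain, integrand `1` on it) with `vol u = vol v` are KZ-equivalent.

Proved here, sorry-free (the hypothesis is written out in full each time; no definition is introduced):
* `equivalent_of_solidVolumes` — `SolidVolumes₃` ⟹ equal-valued representations of dimensions `≤ 2`
  are KZ-equivalent (no rationality hypothesis): reduce both to differences of bounded solids,
  cross-merge, compare volumes by soundness, apply the hypothesis, reassemble in the free abelian group
  (the composition `equivalent_of_stubs` of `Cruxes/ExcursionBudget/Lines/bounded_solids.lean`,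
  cstrat-6259, over the landed stubs);
* `kzDimTwo_of_solidVolumes : SolidVolumes₃ → KZDimTwo` (registered sub-goal of stmt-12472);
* `planarAreas_of_solidVolumes`, `realArcKernel_of_solidVolumes : SolidVolumes₃ →
  ReductionToDimensionTwo → RealArcKernel`, `kontsevichZagierPeriods_of_solidVolumes : SolidVolumes₃ →
  ReductionToDimensionTwo → KontsevichZagierPeriods` (through the landed split glue);
* `solidVolumes_of_kontsevichZagierPeriods` — the summit implies `SolidVolumes₃` (bounded volume
  representations are KZ-rational, integrand `1 / 1`);
* the tail in the same currency, `RedSolid₃` (every `R ≥ KZ.relations` containing the equal-volume pairs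
  of bounded solids of dimension `3` contains `ker KZ.eval`): `sub_mem_of_solidPairs` (relative form of
  the cross-merge), `redSolid_of_reductionToDimensionTwo` (it is WEAKER than stmt-18030),
  `redSolid_of_realArcKernel` (still NECESSARY for the crux), `realArcKernel_of_solidVolumes_of_redSolid`,
  `kontsevichZagierPeriods_of_solidVolumes_of_redSolid` (with `SolidVolumes₃` still SUFFICIENT),
  `redSolid_of_kontsevichZagierPeriods`.

Deliberately NOT here: any attack on `SolidVolumes₃` itself (Hilbert III for bounded `ℚ`-semialgebraic
solids inside the calculus: equal volume must be realised by Newton–Leibniz moves, which kill the Dehn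
invariants of rational polytopes — Sydler 1965 / Jessen 1968 show volume alone does not give scissors
congruence) or on `ReductionToDimensionTwo`.

Sources: M. Kontsevich, D. Zagier, *Periods* (2001), §1.2 (rules (1)–(3), Conjecture 1);
J. Cresson, J. Viu-Sos, *On the equality of periods of Kontsevich–Zagier* (2022), §1; J. Viu-Sos (2021),
Thm. 1.1 / Cor. 2.3.
-/

noncomputable section

open Literature.NumberTheory.Transcendental
open Summit.KontsevichZagierPeriods.KontsevichZagierPeriods.Theses.AbelContraction
  (RealArcKernel PlanarAreas KZDimTwo ReductionToDimensionTwo)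
open Summit.KontsevichZagierPeriods.AbelContraction.RealArcKernelStubSolids (stub_solids)
open Summit.KontsevichZagierPeriods.AbelContraction.RealArcKernelStubMergeSolids (stub_mergeSolids)

namespace Summit.KontsevichZagierPeriods.AbelContraction.RealArcKernelSolidVolumes

/-- **Equal-volume bounded solids control all pairs of dimensions `≤ 2`, relative to any `R`.** If a
subgroup `R ≥ KZ.relations` contains `[u] − [v]` for every two bounded volume representations `u, v` of
dimension `3` with equal volumes, then it contains `[r] − [r′]` for every two representations of
dimensions `n, m ≤ 2` with equal values (`IsRational` is not needed): `[r] ≡ [s] − [s′]`,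
`[r′] ≡ [t] − [t′]` with bounded solids (`stub_solids`), cross-merge `u ≡ [s] + [t′]`, `v ≡ [t] + [s′]`
(`stub_mergeSolids`), `vol u = vol v` by soundness of the moves, so `[u] − [v] ∈ R`, and `[r] − [r′]`
is the signed sum of the four relations and `[u] − [v]`. (For `R = KZ.relations` this is the
composition `equivalent_of_stubs` of `Cruxes/ExcursionBudget/Lines/bounded_solids.lean`, cstrat-6259.)
[cite: KontsevichZagier2001, §1.2 Conjecture 1] -/
theorem sub_mem_of_solidPairs {R : AddSubgroup KZ.FormalRep} (hR : KZ.relations ≤ R)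
    (h3 : ∀ (u v : KZ.IntegralRep 3), (Bornology.IsBounded u.domain ∧ ∀ z ∈ u.domain, u.integrand z = 1) →
      (Bornology.IsBounded v.domain ∧ ∀ z ∈ v.domain, v.integrand z = 1) → u.value = v.value →
      KZ.of u - KZ.of v ∈ R)
    {n m : ℕ} (hn : n ≤ 2) (hm : m ≤ 2) (r : KZ.IntegralRep n) (r' : KZ.IntegralRep m)
    (hv : r.value = r'.value) : KZ.of r - KZ.of r' ∈ R := by
  -- adapted from Cruxes/ExcursionBudget/Lines/bounded_solids.lean `equivalent_of_stubs` (cstrat-6259)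
  obtain ⟨s, s', hs, hs', hrs⟩ := stub_solids hn r
  obtain ⟨t, t', ht, ht', hrt⟩ := stub_solids hm r'
  -- cross-merge: `u = s ⊔ t'`, `v = t ⊔ s'`
  obtain ⟨u, hu, hum⟩ := stub_mergeSolids s t' hs ht'
  obtain ⟨v, hvv, hvm⟩ := stub_mergeSolids t s' ht hs'
  -- the volumes agree: `vol u = vol s + vol t' = vol t + vol s' = vol v`
  have e1 := KZ.eval_eq_zero_of_mem_relations hrs
  have e2 := KZ.eval_eq_zero_of_mem_relations hrt
  have e3 := KZ.eval_eq_zero_of_mem_relations hum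
  have e4 := KZ.eval_eq_zero_of_mem_relations hvm
  simp only [map_sub, KZ.eval_of] at e1 e2 e3 e4
  have huv : u.value = v.value := by linarith
  have hE : KZ.of u - KZ.of v ∈ R := h3 u v hu hvv huv
  -- reassemble `[r] − [r']`
  have e : KZ.of r - KZ.of r' =
      (KZ.of r - (KZ.of s - KZ.of s')) - (KZ.of r' - (KZ.of t - KZ.of t'))
        + (KZ.of u - KZ.of v) - (KZ.of u - KZ.of s - KZ.of t') + (KZ.of v - KZ.of t - KZ.of s') := by
    abel
  rw [e]
  exact add_mem (sub_mem (add_mem (sub_mem (hR hrs) (hR hrt)) hE) (hR hum)) (hR hvm)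

/-- **Hilbert III for bounded solids decides the dimension-two stratum (and more)**: if every two
bounded volume representations of dimension `3` with equal volumes are KZ-equivalent, then every two
representations of dimensions `n, m ≤ 2` with equal values are KZ-equivalent (no rationality
hypothesis) — `sub_mem_of_solidPairs` at `R = KZ.relations`. [cite: KontsevichZagier2001, §1.2 Conjecture 1] -/
theorem equivalent_of_solidVolumes
    (h3 : ∀ (u v : KZ.IntegralRep 3), (Bornology.IsBounded u.domain ∧ ∀ z ∈ u.domain, u.integrand z = 1) →
      (Bornology.IsBounded v.domain ∧ ∀ z ∈ v.domain, v.integrand z = 1) → u.value = v.value →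
      KZ.Equivalent u v)
    {n m : ℕ} (hn : n ≤ 2) (hm : m ≤ 2) (r : KZ.IntegralRep n) (r' : KZ.IntegralRep m)
    (hv : r.value = r'.value) : KZ.Equivalent r r' :=
  sub_mem_of_solidPairs le_rfl h3 hn hm r r' hv

/-- **`SolidVolumes₃ → KZDimTwo`** (registered sub-goal `kzDimTwo_of_solidVolumes` of stmt-12472): Hilbert's
third problem for bounded `ℚ`-semialgebraic solids in `ℝ³`, inside the calculus, implies Conjecture 1 on
the dimension-two stratum (item stmt-4280, shared with HodgeLevel / BianchiHumbert / DessinsDimensionOne).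
[cite: KontsevichZagier2001, §1.2 Conjecture 1] -/
theorem kzDimTwo_of_solidVolumes : (∀ (u v : KZ.IntegralRep 3), (Bornology.IsBounded u.domain ∧ ∀ z ∈ u.domain, u.integrand z = 1) → (Bornology.IsBounded v.domain ∧ ∀ z ∈ v.domain, v.integrand z = 1) → u.value = v.value → KZ.Equivalent u v) → Summit.KontsevichZagierPeriods.KontsevichZagierPeriods.Theses.AbelContraction.KZDimTwo :=
  fun h3 _ _ hn hm r r' _ _ hv => equivalent_of_solidVolumes h3 hn hm r r' hv

/-- `SolidVolumes₃` implies the 1-period layer `PlanarAreas` (stmt-4990), through the stratum.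
[cite: KontsevichZagier2001, §1.2 Conjecture 1] -/
theorem planarAreas_of_solidVolumes
    (h3 : ∀ (u v : KZ.IntegralRep 3), (Bornology.IsBounded u.domain ∧ ∀ z ∈ u.domain, u.integrand z = 1) →
      (Bornology.IsBounded v.domain ∧ ∀ z ∈ v.domain, v.integrand z = 1) → u.value = v.value →
      KZ.Equivalent u v) : PlanarAreas :=
  Summit.KontsevichZagierPeriods.AbelContraction.RealArcKernelSplit.planarAreas_of_kzDimTwo
    (kzDimTwo_of_solidVolumes h3)

/-- **The crux from `SolidVolumes₃` and the reduction**: `SolidVolumes₃ → ReductionToDimensionTwo →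
RealArcKernel` (landed split glue `realArcKernel_of_subs`). This is the reshaped skeleton of line
`dimtwo_redirect` with both remaining stubs open problems stated by name.
[cite: KontsevichZagier2001, §1.2 Conjecture 1] -/
theorem realArcKernel_of_solidVolumes
    (h3 : ∀ (u v : KZ.IntegralRep 3), (Bornology.IsBounded u.domain ∧ ∀ z ∈ u.domain, u.integrand z = 1) →
      (Bornology.IsBounded v.domain ∧ ∀ z ∈ v.domain, v.integrand z = 1) → u.value = v.value →
      KZ.Equivalent u v)
    (hRed : ReductionToDimensionTwo) : RealArcKernel :=
  Summit.KontsevichZagierPeriods.AbelContraction.RealArcKernelSplit.realArcKernel_of_subs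
    (kzDimTwo_of_solidVolumes h3) hRed

/-- **The summit from `SolidVolumes₃` and the reduction** (landed `kontsevichZagierPeriods_of_subs`).
[cite: KontsevichZagier2001, §1.2 Conjecture 1] -/
theorem kontsevichZagierPeriods_of_solidVolumes
    (h3 : ∀ (u v : KZ.IntegralRep 3), (Bornology.IsBounded u.domain ∧ ∀ z ∈ u.domain, u.integrand z = 1) →
      (Bornology.IsBounded v.domain ∧ ∀ z ∈ v.domain, v.integrand z = 1) → u.value = v.value →
      KZ.Equivalent u v)
    (hRed : ReductionToDimensionTwo) : KontsevichZagierPeriods :=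
  Summit.KontsevichZagierPeriods.AbelContraction.RealArcKernelSplit.kontsevichZagierPeriods_of_subs
    (kzDimTwo_of_solidVolumes h3) hRed

/-- A representation with integrand `1` on its domain has KZ's literal (rational) shape (`1 / 1`).
[cite: KontsevichZagier2001, §1.1 Definition] -/
theorem isRational_of_integrand_eq_one {N : ℕ} (u : KZ.IntegralRep N)
    (hu : ∀ z ∈ u.domain, u.integrand z = 1) : u.IsRational :=
  ⟨1, 1, fun _ _ => by simp, fun z hz => by simp [hu z hz]⟩

/-- **The summit implies `SolidVolumes₃`** (bounded volume representations are KZ-rational), so the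
reshaped stub is, like every stub of this crux, a consequence of Conjecture 1.
[cite: KontsevichZagier2001, §1.2 Conjecture 1] -/
theorem solidVolumes_of_kontsevichZagierPeriods (h : KontsevichZagierPeriods) :
    ∀ (u v : KZ.IntegralRep 3), (Bornology.IsBounded u.domain ∧ ∀ z ∈ u.domain, u.integrand z = 1) →
      (Bornology.IsBounded v.domain ∧ ∀ z ∈ v.domain, v.integrand z = 1) → u.value = v.value →
      KZ.Equivalent u v :=
  fun u v hu hv huv => h u v (isRational_of_integrand_eq_one u hu.2) (isRational_of_integrand_eq_one v hv.2) huv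

/-! ## The tail in the same currency: the kernel conjecture modulo equal-volume bounded solids

`RedSolid₃` : every subgroup `R ≥ KZ.relations` containing `[u] − [v]` for every two bounded volume
representations of dimension `3` with equal volumes contains `ker KZ.eval`. It is WEAKER than
`ReductionToDimensionTwo` (its hypothesis is stronger, `sub_mem_of_solidPairs`), still NECESSARY for the
crux, and together with `SolidVolumes₃` it still gives the crux and the summit — so in the bounded-solids
currency the crux splits as `SolidVolumes₃ ∧ RedSolid₃` (recorded for the planners; `RedSolid₃` is not a
route item and is written out in full). -/

/-- **`ReductionToDimensionTwo → RedSolid₃`** (monotonicity: equal-volume bounded solids in `R` put all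
equal-valued KZ-rational pairs of dimensions `≤ 2` in `R`, `sub_mem_of_solidPairs`).
[cite: KontsevichZagier2001, §1.2 Conjecture 1] -/
theorem redSolid_of_reductionToDimensionTwo (hRed : ReductionToDimensionTwo) :
    ∀ R : AddSubgroup KZ.FormalRep, KZ.relations ≤ R →
      (∀ (u v : KZ.IntegralRep 3), (Bornology.IsBounded u.domain ∧ ∀ z ∈ u.domain, u.integrand z = 1) →
        (Bornology.IsBounded v.domain ∧ ∀ z ∈ v.domain, v.integrand z = 1) → u.value = v.value →
        KZ.of u - KZ.of v ∈ R) →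
      ∀ x : KZ.FormalRep, KZ.eval x = 0 → x ∈ R :=
  fun R hR h3 x hx => hRed R hR (fun _ _ hn hm r r' _ _ hv => sub_mem_of_solidPairs hR h3 hn hm r r' hv) x hx

/-- **`RedSolid₃` is NECESSARY for the crux**: `RealArcKernel → RedSolid₃` (landed
`reductionToDimensionTwo_of_realArcKernel`, then `redSolid_of_reductionToDimensionTwo`).
[cite: KontsevichZagier2001, §1.2 Conjecture 1] -/
theorem redSolid_of_realArcKernel (h : RealArcKernel) :
    ∀ R : AddSubgroup KZ.FormalRep, KZ.relations ≤ R →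
      (∀ (u v : KZ.IntegralRep 3), (Bornology.IsBounded u.domain ∧ ∀ z ∈ u.domain, u.integrand z = 1) →
        (Bornology.IsBounded v.domain ∧ ∀ z ∈ v.domain, v.integrand z = 1) → u.value = v.value →
        KZ.of u - KZ.of v ∈ R) →
      ∀ x : KZ.FormalRep, KZ.eval x = 0 → x ∈ R :=
  redSolid_of_reductionToDimensionTwo
    (Summit.KontsevichZagierPeriods.AbelContraction.RealArcKernelSplit.reductionToDimensionTwo_of_realArcKernel h)

/-- **The crux in the bounded-solids currency**: `SolidVolumes₃ → RedSolid₃ → RealArcKernel` — given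
`R ≥ KZ.relations`, Hilbert III puts every equal-volume pair of bounded solids inside `KZ.relations ≤ R`,
and the reduction then puts `ker KZ.eval` inside `R`; the sector hypothesis is discarded.
[cite: KontsevichZagier2001, §1.2 Conjecture 1] -/
theorem realArcKernel_of_solidVolumes_of_redSolid
    (h3 : ∀ (u v : KZ.IntegralRep 3), (Bornology.IsBounded u.domain ∧ ∀ z ∈ u.domain, u.integrand z = 1) →
      (Bornology.IsBounded v.domain ∧ ∀ z ∈ v.domain, v.integrand z = 1) → u.value = v.value →
      KZ.Equivalent u v)
    (hRed : ∀ R : AddSubgroup KZ.FormalRep, KZ.relations ≤ R →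
      (∀ (u v : KZ.IntegralRep 3), (Bornology.IsBounded u.domain ∧ ∀ z ∈ u.domain, u.integrand z = 1) →
        (Bornology.IsBounded v.domain ∧ ∀ z ∈ v.domain, v.integrand z = 1) → u.value = v.value →
        KZ.of u - KZ.of v ∈ R) →
      ∀ x : KZ.FormalRep, KZ.eval x = 0 → x ∈ R) : RealArcKernel := by
  unfold Summit.KontsevichZagierPeriods.KontsevichZagierPeriods.Theses.AbelContraction.RealArcKernel
  intro R hR _ x hx
  exact hRed R hR (fun u v hu hv huv => hR (h3 u v hu hv huv)) x hx

/-- **The summit in the bounded-solids currency**: `SolidVolumes₃ → RedSolid₃ → KontsevichZagierPeriods`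
(at `R = KZ.relations` the reduction gives the kernel form `KZKernelConjecture`, equivalent to the summit
by `kzKernelConjecture_iff_isRational`). [cite: KontsevichZagier2001, §1.2 Conjecture 1] -/
theorem kontsevichZagierPeriods_of_solidVolumes_of_redSolid
    (h3 : ∀ (u v : KZ.IntegralRep 3), (Bornology.IsBounded u.domain ∧ ∀ z ∈ u.domain, u.integrand z = 1) →
      (Bornology.IsBounded v.domain ∧ ∀ z ∈ v.domain, v.integrand z = 1) → u.value = v.value →
      KZ.Equivalent u v)
    (hRed : ∀ R : AddSubgroup KZ.FormalRep, KZ.relations ≤ R →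
      (∀ (u v : KZ.IntegralRep 3), (Bornology.IsBounded u.domain ∧ ∀ z ∈ u.domain, u.integrand z = 1) →
        (Bornology.IsBounded v.domain ∧ ∀ z ∈ v.domain, v.integrand z = 1) → u.value = v.value →
        KZ.of u - KZ.of v ∈ R) →
      ∀ x : KZ.FormalRep, KZ.eval x = 0 → x ∈ R) : KontsevichZagierPeriods :=
  kzKernelConjecture_iff_isRational.mp fun x hx => hRed KZ.relations le_rfl h3 x hx

/-- The summit implies `RedSolid₃` (through the crux). [cite: KontsevichZagier2001, §1.2 Conjecture 1] -/
theorem redSolid_of_kontsevichZagierPeriods (h : KontsevichZagierPeriods) :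
    ∀ R : AddSubgroup KZ.FormalRep, KZ.relations ≤ R →
      (∀ (u v : KZ.IntegralRep 3), (Bornology.IsBounded u.domain ∧ ∀ z ∈ u.domain, u.integrand z = 1) →
        (Bornology.IsBounded v.domain ∧ ∀ z ∈ v.domain, v.integrand z = 1) → u.value = v.value →
        KZ.of u - KZ.of v ∈ R) →
      ∀ x : KZ.FormalRep, KZ.eval x = 0 → x ∈ R :=
  redSolid_of_realArcKernel
    (Summit.KontsevichZagierPeriods.AbelContraction.RealArcKernelStrength.realArcKernel_of_kontsevichZagierPeriods h)

end Summit.KontsevichZagierPeriods.AbelContraction.RealArcKernelSolidVolumes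

end
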